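/-
Copyright: rh-split cell (screw, bridge) gen 19, 2026-08-28.  Splitting search over kernel-typed
RH-equivalences.  A splitting `A ∧ B ⟹ RH` is CONDITIONAL bookkeeping unless `A` and `B` are both
proved; nothing here bears on the truth of RH.
-/
import Summits.RiemannHypothesis.RiemannHypothesis.Theorems.Splittings.ScrewPrimeCellBlindnessB

/-!
# §24 «PRIME-CELL BLINDNESS» — part C of 4: §§7–8 (matched families, screw reading for families)

Carved at section boundaries from the single refereed object `ScrewPrimeCellBlindness.lean`
(rh-split cell (screw, bridge) gen 19; sha16 7ccfa4f57a1815af · 1038 l) to meet the tree line limit;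
the mathematical module docstring of record is in part A (`ScrewPrimeCellBlindnessA`).
HONEST LABEL: kernel algebra about finite prime sums; an INSTRUMENT / barrier note for the screw
column, not a splitting; RH-free; toward RH: 0.  Nothing here bears on the truth of RH.
-/

set_option linter.dupNamespace false

namespace Summit.RiemannHypothesis.RiemannHypothesis.Theorems.Splittings.ScrewPrimeCellBlindness

open Literature.NumberTheory.LFunctions
open Summit.RiemannHypothesis.RiemannHypothesis.Theorems.Splittings.ScrewLatticeContinuation
  (LatticeCeiling)

/-! ## 7. Matched families of tents: the pointwise-`η` class

A finite family of tents `(a i, b i, c i, β i)`, `i ∈ s`, with pairwise DISJOINT supports: every integer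
carries at most one spike, so the pointwise relative bound `|δ(n)| ≤ η w(n)` of a single tent survives
superposition (`abs_tentFamily_le_mul`), while blindness and the exact left-edge formula add up. -/

section family

variable {ι : Type*} (s : Finset ι) (a b c : ι → ℕ) (β : ι → ℝ)

/-- Superposition of the tents `(a i, b i, c i)` with apex weights `β i`, `i ∈ s`. -/
noncomputable def tentFamily : ℕ → ℝ := fun n ↦ ∑ i ∈ s, tent (a i) (b i) (c i) (β i) n

/-- `φ` of a tent family is the sum of the `φ`'s of its tents. -/
theorem primeSumW_tentFamily (t : ℝ) :
    primeSumW (tentFamily s a b c β) t = ∑ i ∈ s, primeSumW (tent (a i) (b i) (c i) (β i)) t :=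
  primeSumW_finset_sum s (fun i ↦ tent (a i) (b i) (c i) (β i)) t

variable {s a b c} (hs : ∀ i ∈ s, 1 ≤ a i ∧ a i < b i ∧ b i < c i) (w : ℕ → ℝ)
include hs

/-- Window blindness of the family: if every window `(log a i, log c i)` lies inside `(A, C)`, then
outside `(A, C)` the family is invisible. -/
theorem primeSumW_add_tentFamily_eq_of_window {A C : ℝ}
    (hwin : ∀ i ∈ s, A ≤ Real.log (a i) ∧ Real.log (c i) ≤ C) {t : ℝ} (ht : |t| ≤ A ∨ C ≤ |t|) :
    primeSumW (w + tentFamily s a b c β) t = primeSumW w t := by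
  rw [primeSumW_add, primeSumW_tentFamily, Finset.sum_eq_zero, add_zero]
  intro i hi
  obtain ⟨h1, h2, h3⟩ := hs i hi
  obtain ⟨hA, hC⟩ := hwin i hi
  rcases ht with ht | ht
  · exact primeSumW_tent_of_le_log h1 h2 h3 _ (ht.trans hA)
  · exact primeSumW_tent_of_log_le h1 h2 h3 _ (hC.trans ht)

/-- Lattice blindness of the family inside one cell `[k h, (k+1) h]`. -/
theorem primeSumW_add_tentFamily_lattice {h : ℝ} (hh : 0 ≤ h) {k : ℕ}
    (hwin : ∀ i ∈ s, k * h ≤ Real.log (a i) ∧ Real.log (c i) ≤ (k + 1) * h) (j : ℕ) :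
    primeSumW (w + tentFamily s a b c β) (j * h) = primeSumW w (j * h) := by
  refine primeSumW_add_tentFamily_eq_of_window β hs w hwin ?_
  rw [abs_of_nonneg (by positivity)]
  rcases Nat.lt_or_ge j (k + 1) with hj | hj
  · left
    have hj' : (j : ℝ) ≤ k := by exact_mod_cast Nat.lt_succ_iff.1 hj
    exact mul_le_mul_of_nonneg_right hj' hh
  · right
    have hj' : ((k : ℝ) + 1) ≤ j := by exact_mod_cast hj
    exact mul_le_mul_of_nonneg_right hj' hh

/-- **Exact deviation left of all apexes**: if `log a i ≤ |t| ≤ log b i` for every `i`, then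
`φ_{w + family}(t) - φ_w(t) = ∑_i β_i (log c_i - log b_i)/(log c_i - log a_i) · (|t| - log a_i)`. -/
theorem primeSumW_add_tentFamily_left {t : ℝ}
    (ht : ∀ i ∈ s, Real.log (a i) ≤ |t| ∧ |t| ≤ Real.log (b i)) :
    primeSumW (w + tentFamily s a b c β) t - primeSumW w t =
      ∑ i ∈ s, β i * (Real.log (c i) - Real.log (b i)) / (Real.log (c i) - Real.log (a i)) *
        (|t| - Real.log (a i)) := by
  rw [primeSumW_add, add_sub_cancel_left, primeSumW_tentFamily]
  refine Finset.sum_congr rfl fun i hi ↦ ?_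
  obtain ⟨h1, h2, h3⟩ := hs i hi
  exact primeSumW_tent_of_mem_left h1 h2 h3 _ (ht i hi).1 (ht i hi).2

/-- **Uniform lower bound** for non-negative apex weights: if all left feet satisfy `log a_i ≤ A₁ ≤ |t|`,
all apexes `log b_i ≤ M`, all right feet `C₁ ≤ log c_i` (`M ≤ C₁` in applications), and all windows have
log-length `≤ L` (`log c_i - log a_i ≤ L`, `0 < L`), then the deviation is at least
`(|t| - A₁)(C₁ - M)/L · ∑_i β_i`. -/
theorem primeSumW_add_tentFamily_left_ge {t A₁ M C₁ L : ℝ} (hL : 0 < L)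
    (ht : ∀ i ∈ s, Real.log (a i) ≤ |t| ∧ |t| ≤ Real.log (b i))
    (hA : ∀ i ∈ s, Real.log (a i) ≤ A₁) (htA : A₁ ≤ |t|) (hM : ∀ i ∈ s, Real.log (b i) ≤ M)
    (hC : ∀ i ∈ s, C₁ ≤ Real.log (c i))
    (hLi : ∀ i ∈ s, Real.log (c i) - Real.log (a i) ≤ L) (hβ : ∀ i ∈ s, 0 ≤ β i) :
    (|t| - A₁) * (C₁ - M) / L * ∑ i ∈ s, β i ≤
      primeSumW (w + tentFamily s a b c β) t - primeSumW w t := by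
  rw [primeSumW_add_tentFamily_left β hs w ht, Finset.mul_sum]
  refine Finset.sum_le_sum fun i hi ↦ ?_
  obtain ⟨h1, h2, h3⟩ := hs i hi
  have hab : Real.log (a i) < Real.log (b i) :=
    Real.log_lt_log (by exact_mod_cast h1) (by exact_mod_cast h2)
  have hbc : Real.log (b i) < Real.log (c i) :=
    Real.log_lt_log (by exact_mod_cast (show 0 < b i by omega)) (by exact_mod_cast h3)
  have hLi0 : 0 < Real.log (c i) - Real.log (a i) := by linarith
  -- compare factor by factor: (|t| - A₁) ≤ (|t| - log a_i), (C₁ - M) ≤ (log c_i - log b_i), 1/L ≤ 1/L_i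
  have e1 : (|t| - A₁) * (C₁ - M) / L * β i =
      β i * ((C₁ - M) * (|t| - A₁) / L) := by ring
  have e2 : β i * (Real.log (c i) - Real.log (b i)) / (Real.log (c i) - Real.log (a i)) *
      (|t| - Real.log (a i)) =
      β i * ((Real.log (c i) - Real.log (b i)) * (|t| - Real.log (a i)) /
        (Real.log (c i) - Real.log (a i))) := by ring
  rw [e1, e2]
  refine mul_le_mul_of_nonneg_left ?_ (hβ i hi)
  have hnum : (C₁ - M) * (|t| - A₁) ≤
      (Real.log (c i) - Real.log (b i)) * (|t| - Real.log (a i)) :=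
    mul_le_mul (by linarith [hC i hi, hM i hi]) (by linarith [hA i hi]) (by linarith)
      (by linarith [hC i hi, hM i hi])
  have hnn : 0 ≤ (Real.log (c i) - Real.log (b i)) * (|t| - Real.log (a i)) :=
    mul_nonneg (by linarith) (by linarith [hA i hi])
  calc (C₁ - M) * (|t| - A₁) / L
      ≤ (Real.log (c i) - Real.log (b i)) * (|t| - Real.log (a i)) / L :=
        div_le_div_of_nonneg_right hnum hL.le
    _ ≤ (Real.log (c i) - Real.log (b i)) * (|t| - Real.log (a i)) /
          (Real.log (c i) - Real.log (a i)) :=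
        div_le_div_of_nonneg_left hnn hLi0 (hLi i hi)

omit hs in
/-- With pairwise disjoint supports every integer carries at most one spike, so the pointwise relative
bound of `abs_tent_le_mul` survives superposition: `|family(n)| ≤ η w(n)` for every `n`. -/
theorem abs_tentFamily_le_mul (hs : ∀ i ∈ s, 1 ≤ a i ∧ a i < b i ∧ b i < c i) {η : ℝ}
    (hw : ∀ n, 0 ≤ w n) (hη : 0 ≤ η)
    (hdis : ∀ i ∈ s, ∀ j ∈ s, i ≠ j →
      ∀ x ∈ ({a i, b i, c i} : Finset ℕ), x ∉ ({a j, b j, c j} : Finset ℕ))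
    (hβa : ∀ i ∈ s, |β i| * Real.sqrt (a i) ≤ η * w (a i))
    (hβb : ∀ i ∈ s, |β i| * Real.sqrt (b i) ≤ η * w (b i))
    (hβc : ∀ i ∈ s, |β i| * Real.sqrt (c i) ≤ η * w (c i)) (n : ℕ) :
    |tentFamily s a b c β n| ≤ η * w n := by
  unfold tentFamily
  by_cases hn : ∃ i ∈ s, n ∈ ({a i, b i, c i} : Finset ℕ)
  · obtain ⟨i, hi, hni⟩ := hn
    rw [Finset.sum_eq_single_of_mem i hi (fun j hj hji ↦ ?_)]
    · obtain ⟨h1, h2, h3⟩ := hs i hi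
      exact abs_tent_le_mul h1 h2 h3 hw hη (hβa i hi) (hβb i hi) (hβc i hi) n
    · have hnj : n ∉ ({a j, b j, c j} : Finset ℕ) := hdis i hi j hj (Ne.symm hji) n hni
      simp only [Finset.mem_insert, Finset.mem_singleton, not_or] at hnj
      exact tent_apply_of_ne (β j) hnj.1 hnj.2.1 hnj.2.2
  · push Not at hn
    rw [Finset.sum_eq_zero (fun j hj ↦ ?_), abs_zero]
    · exact mul_nonneg hη (hw n)
    · have hnj := hn j hj
      simp only [Finset.mem_insert, Finset.mem_singleton, not_or] at hnj
      exact tent_apply_of_ne (β j) hnj.1 hnj.2.1 hnj.2.2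

omit hs in
/-- Hence (`η ≤ 1`) the perturbed weights stay non-negative and supported inside the support of `w`. -/
theorem add_tentFamily_nonneg (hs : ∀ i ∈ s, 1 ≤ a i ∧ a i < b i ∧ b i < c i) {η : ℝ}
    (hw : ∀ n, 0 ≤ w n) (hη : 0 ≤ η) (hη1 : η ≤ 1)
    (hdis : ∀ i ∈ s, ∀ j ∈ s, i ≠ j →
      ∀ x ∈ ({a i, b i, c i} : Finset ℕ), x ∉ ({a j, b j, c j} : Finset ℕ))
    (hβa : ∀ i ∈ s, |β i| * Real.sqrt (a i) ≤ η * w (a i))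
    (hβb : ∀ i ∈ s, |β i| * Real.sqrt (b i) ≤ η * w (b i))
    (hβc : ∀ i ∈ s, |β i| * Real.sqrt (c i) ≤ η * w (c i)) (n : ℕ) :
    0 ≤ (w + tentFamily s a b c β) n ∧ (w n = 0 → (w + tentFamily s a b c β) n = 0) := by
  have h := abs_tentFamily_le_mul β w hs hw hη hdis hβa hβb hβc n
  have hwn := hw n
  have h' : |tentFamily s a b c β n| ≤ w n := h.trans (by nlinarith)
  rw [abs_le] at h'
  refine ⟨by rw [Pi.add_apply]; linarith, fun h0 ↦ ?_⟩
  rw [Pi.add_apply, h0, zero_add]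
  have : |tentFamily s a b c β n| ≤ 0 := h.trans (by rw [h0, mul_zero])
  exact abs_nonpos_iff.1 this

end family

/-! ## 8. The screw reading for families -/

/-- A lattice-blind family does not change one lattice sample of `Ψ` … -/
theorem screwW_add_tentFamily_lattice {ι : Type*} {s : Finset ι} {a b c : ι → ℕ} (β : ι → ℝ)
    (hs : ∀ i ∈ s, 1 ≤ a i ∧ a i < b i ∧ b i < c i) {h : ℝ} (hh : 0 ≤ h) {k : ℕ}
    (hwin : ∀ i ∈ s, k * h ≤ Real.log (a i) ∧ Real.log (c i) ≤ (k + 1) * h) (j : ℕ) :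
    screwW ((fun n ↦ ArithmeticFunction.vonMangoldt n) + tentFamily s a b c β) (j * h) =
      zetaScrew (j * h) := by
  rw [screwW, primeSumW_add_tentFamily_lattice β hs _ hh hwin j, primeSumW_vonMangoldt,
    add_sub_cancel_right]

/-- … so its lattice ceiling is literally `CEIL(h)` … -/
theorem latticeCeilingW_add_tentFamily_iff {ι : Type*} {s : Finset ι} {a b c : ι → ℕ} (β : ι → ℝ)
    (hs : ∀ i ∈ s, 1 ≤ a i ∧ a i < b i ∧ b i < c i) {h : ℝ} (hh : 0 ≤ h) {k : ℕ}
    (hwin : ∀ i ∈ s, k * h ≤ Real.log (a i) ∧ Real.log (c i) ≤ (k + 1) * h) :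
    LatticeCeilingW ((fun n ↦ ArithmeticFunction.vonMangoldt n) + tentFamily s a b c β) h ↔
      LatticeCeiling h := by
  simp only [LatticeCeilingW, LatticeCeiling, screwW_add_tentFamily_lattice β hs hh hwin]

/-- … while between the samples `Ψ` drops by exactly the family's deviation. -/
theorem screwW_add_tentFamily_eq {ι : Type*} (s : Finset ι) (a b c : ι → ℕ) (β : ι → ℝ) (t : ℝ) :
    screwW ((fun n ↦ ArithmeticFunction.vonMangoldt n) + tentFamily s a b c β) t =
      zetaScrew t - (primeSumW ((fun n ↦ (ArithmeticFunction.vonMangoldt n : ℝ)) +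
        tentFamily s a b c β) t - primeSumW (fun n ↦ ArithmeticFunction.vonMangoldt n) t) := by
  rw [screwW, primeSumW_vonMangoldt]
  ring


end Summit.RiemannHypothesis.RiemannHypothesis.Theorems.Splittings.ScrewPrimeCellBlindness
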